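import Summits.HodgeConjecture.HodgeConjecture.Theorems.VHCAbelianSchemesRoadLocallyServedAnchor
import Summits.HodgeConjecture.HodgeConjecture.Theorems.VHCAbelianSchemesRoadSecantQuotientAnchorPinnedDefs
import Literature.AlgebraicGeometry.HodgeTheory.SecantQuotientJacobianTwistedCarrierForall
import Summits.HodgeConjecture.HodgeConjecture.Theorems.VHCAbelianSchemesRoadSecantQuotientServedLefschetz
import Literature.AlgebraicGeometry.HodgeTheory.AlgebraicClassesHodgeTypeHolds
import Summits.HodgeConjecture.HodgeConjecture.Theorems.VHCAbelianSchemesRoadDegreeConfinement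
import HarnessLib

/-!
# Road b02 (`VHCAbelianSchemesRoad`) — `AnchorReachableAt`: MONOTONICITY, ISO-TRANSPORT, SELF-ANCHORING; THE RESIDUAL SEAM (EXACT)

research route conditional on HC_CM; not a corollary; Q11.4-sentence-2 already refuted in dim ≥ 3.

THEOREMS ONLY (door-, degree-, anchor-generic; fact-free; no `sorry`; `HC_CM` occurs nowhere). Seat ring2-b03x gen 16 (director-hodge g16
req-40), helper `--supports stmt-HodgeConjecture-26512` for stub 2r″ `stub_localResidualPairs_63_OffHypDisjEndTwPrime` of skeleton v3.12b
(`Cruxes/DiagLocalOfMarkmanPinnedForall/Lines/birth.lean`, e7ce30df245290c2). Nothing here closes 2r″; the file makes its GROWTH under the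
v3.12 re-key (anchor family oH ↦ oHE: the presenting secant–quotient datum is moreover `End`-trivial) an EXACT kernel statement.
§1 API of `AnchorReachableAt n p 𝔄 𝔘 𝔏 X w` (`…LocallyServedAnchor.lean` :124): `.mono` (monotone in `𝔄`, `𝔏`; antitone in `𝔘`),
`.mono_anchors`, `.of_iso`, `.of_self` (constant pencil `Y × 𝔸¹`). §2 the residual-pairs statement «every non-algebraic-Lefschetz,
non-`𝔄`-reachable pair is locally served» is ANTITONE in `𝔄` (`localResidualPairs_antitone` — «IT GROWS», certified) and follows for the
SMALLER family from the LARGER family's residual ∧ the REACHABILITY TRANSFER «reachable from the larger family ⟹ reachable from the smaller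
one, or served» (`localResidualPairs_of_transfer`; on paper the transfer is the D1b density lemma with «general» ↦ «very general», LEAD 163
K0, ring2 INBOX l.5579 — displayed, not claimed). §3 the `(6,3)` instances, anchor families of record verbatim (oH = v3.11, oHE = v3.12):
`localResidualPairs_63_offHypDisj_of_offHypDisjEnd` (2r″ ⟹ 2r′ᵒᴴ), `localResidualPairs_63_offHypDisjEnd_of_offHypDisj_of_transfer`
(2r′ᵒᴴ ∧ (T) ⟹ 2r″). §4 `anchorReachableAt_63_secantQuotientPinned_of_self` (every PRESENTED pinned anchor reaches its own rational
`𝔖^pin + ℂθ³` classes; with `secantQuotientServedClassesPinned_subset_lefschetz` the anchors contribute nothing to the residual as targets),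
`anchorReachableAt_63_offHypDisj_of_offHypDisjEnd`. §5 EXACTNESS: `transfer_of_localResidualPairs`, `localResidualPairs_iff_of_le`
(residual(𝔄) ⟺ residual(𝔄′) ∧ transfer, 𝔄 ≤ 𝔄′), `localResidualPairs_63_offHypDisjEnd_iff` (2r″ ⟺ 2r′ᵒᴴ ∧ (T)),
`not_algebraic_and_lefschetz_iff_not_mem_divisorClassesSpan_of_abelian` (the exclusion clause is `w ∉ Dᵖ ⊗ ℂ`).
References: [Markman2025SecantWeil] §1.5, Thm. 1.5.1; [Andre1996Motifs] §6.3; [DeligneHodgeII1971] 4.1.2; [Hartshorne1977] II.3; [vanGeemen1994HodgeAV] §2.4.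
-/
noncomputable section

open CategoryTheory CategoryTheory.Limits AlgebraicGeometry Topology MonoidalCategory CartesianMonoidalCategory

namespace Summit.HodgeConjecture.HodgeConjecture.Ring2.SemiregularRepresentatives

set_option linter.dupNamespace false -- the cell's namespace repeats the summit name, as in every `Ring2*` file

open Literature.AlgebraicGeometry Literature.AlgebraicGeometry.Motives Literature.AlgebraicGeometry.Motives.AbelianVariety
open Literature.AlgebraicGeometry.HodgeTheory Literature.AlgebraicGeometry.Markman2025
open Literature.AlgebraicTopology.SingularHomology
open Literature.Barriers.HodgeConjecture (divisorClassesSpan)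
open Summit.Ventures.HSemireg (ObjClass)

variable {𝒪 : ObjClass} {n p : ℕ} {𝔄 𝔄' : ∀ X : SchemeOver ℂ, complexBetti X 2 → Prop}
  {𝔘 𝔘' 𝔏 𝔏' : ∀ (X : SchemeOver ℂ), complexBetti X 2 → Set (complexBetti X (2 * p))}
  {X : SchemeOver ℂ} {w : complexBetti X (2 * p)}

/-! ## §1 `AnchorReachableAt`: monotonicity, iso-transport, self-anchoring -/

/-- **Monotonicity of anchor-reachability**: MONOTONE in the anchor family `𝔄` (more anchors reach more pairs) and in the joining set
`𝔏` (more admissible end-classes `w_Y`), ANTITONE in `𝔘` (fewer directions required to extend along the pencil). The same pencil, anchor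
fibre, global classes and joining class serve. [cite: Markman2025SecantWeil, §1.5 and Thm. 1.5.1] -/
theorem AnchorReachableAt.mono (h𝔄 : ∀ Y θ, 𝔄 Y θ → 𝔄' Y θ) (h𝔘 : ∀ Y θ, 𝔘' Y θ ⊆ 𝔘 Y θ) (h𝔏 : ∀ Y θ, 𝔏 Y θ ⊆ 𝔏' Y θ)
    (h : AnchorReachableAt n p 𝔄 𝔘 𝔏 X w) : AnchorReachableAt n p 𝔄' 𝔘' 𝔏' X w := by
  obtain ⟨𝒳', S', f', s₁, t', Y, θY, eY, eX, Θ', wY, G, hf', h𝒳', hirr', haff', hsm', hdim', hY, hΘQ, hΘH, hΘs₁, hext, hwY, hwYQ,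
    hGs₁, hGt'⟩ := h
  exact ⟨𝒳', S', f', s₁, t', Y, θY, eY, eX, Θ', wY, G, hf', h𝒳', hirr', haff', hsm', hdim', h𝔄 Y θY hY, hΘQ, hΘH, hΘs₁,
    fun u₀ hu₀ hu₀Q ↦ hext u₀ (h𝔘 Y θY hu₀) hu₀Q, h𝔏 Y θY hwY, hwYQ, hGs₁, hGt'⟩

/-- **Monotonicity in the anchor family alone.** [cite: Markman2025SecantWeil, §1.5 and Thm. 1.5.1] -/
theorem AnchorReachableAt.mono_anchors (h𝔄 : ∀ Y θ, 𝔄 Y θ → 𝔄' Y θ) (h : AnchorReachableAt n p 𝔄 𝔘 𝔏 X w) :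
    AnchorReachableAt n p 𝔄' 𝔘 𝔏 X w :=
  h.mono h𝔄 (fun _ _ ↦ subset_rfl) (fun _ _ ↦ subset_rfl)

/-- **Transport in the target along an isomorphism**: if `(X, w)` is anchor-reachable and `e : X₁ ≅ X`, so is `(X₁, e^* w)` (compose the
target fibre isomorphism with `e⁻¹`). [cite: GrothendieckTopology1969, §1] -/
theorem AnchorReachableAt.of_iso (h : AnchorReachableAt n p 𝔄 𝔘 𝔏 X w) {X₁ : SchemeOver ℂ} (e : X₁ ≅ X) :
    AnchorReachableAt n p 𝔄 𝔘 𝔏 X₁ (complexBetti.map e.hom (2 * p) w) := by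
  obtain ⟨𝒳', S', f', s₁, t', Y, θY, eY, eX, Θ', wY, G, hf', h𝒳', hirr', haff', hsm', hdim', hY, hΘQ, hΘH, hΘs₁, hext, hwY, hwYQ,
    hGs₁, hGt'⟩ := h
  refine ⟨𝒳', S', f', s₁, t', Y, θY, eY, eX ≪≫ e.symm, Θ', wY, G, hf', h𝒳', hirr', haff', hsm', hdim', hY, hΘQ, hΘH, hΘs₁, hext,
    hwY, hwYQ, hGs₁, ?_⟩
  rw [hGt', Iso.trans_hom, Iso.symm_hom, complexBetti.map_comp]
  change _ = complexBetti.map eX.hom (2 * p) (complexBetti.map e.inv (2 * p) (complexBetti.map e.hom (2 * p) w))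
  rw [e.complexBetti_map_inv_map_hom]

/-- **An anchor reaches each of its own rational `𝔏`-classes** (the CONSTANT pencil `Y × 𝔸¹ ⟶ 𝔸¹`, anchor fibre = target fibre, all
global classes pulled back along `pr₁`): if `Y` is a smooth projective `n`-fold, `𝔄 Y θ`, `θ` is a rational `(1,1)`-class, every rational
`u ∈ 𝔘 Y θ` is of type `(p,p)`, and `w ∈ 𝔏 Y θ` is rational, then `AnchorReachableAt n p 𝔄 𝔘 𝔏 Y w`. So no anchor's own `𝔏`-pair is
ever in the residual of its own family. [cite: Hartshorne1977, II.3 (p. 89)] [cite: Markman2025SecantWeil, §1.5] -/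
theorem AnchorReachableAt.of_self {Y : SchemeOver ℂ} {θ : complexBetti Y 2} (hY : IsSmoothProjective n Y) (h𝔄Y : 𝔄 Y θ)
    (hθQ : IsRationalClass θ) (hθH : IsOfHodgeType n Y 2 1 1 θ)
    (h𝔘 : ∀ u ∈ 𝔘 Y θ, IsRationalClass u → IsOfHodgeType n Y (2 * p) p p u)
    {w : complexBetti Y (2 * p)} (hw : w ∈ 𝔏 Y θ) (hwQ : IsRationalClass w) :
    AnchorReachableAt n p 𝔄 𝔘 𝔏 Y w := by
  haveI : IrreducibleSpace (specOver ℂ (MvPolynomial (Fin 1) ℂ)).left := irreducibleSpace_affineLine_left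
  haveI : IsAffine (specOver ℂ (MvPolynomial (Fin 1) ℂ)).left := isAffine_affineLine_left
  obtain ⟨s₀⟩ := nonempty_complexPoints_affineLine
  have hf' : IsSmoothProjectiveFamily (snd Y (specOver ℂ (MvPolynomial (Fin 1) ℂ))) n := isSmoothProjectiveFamily_snd hY _
  have h𝒳' : IsQuasiProjectiveOver (Y ⊗ specOver ℂ (MvPolynomial (Fin 1) ℂ)) :=
    isQuasiProjectiveOver_tensor_of_isProjectiveOver hY.isProjectiveOver isQuasiProjectiveOver_affineLine
  have hres := fun (u : ComplexPoints (specOver ℂ (MvPolynomial (Fin 1) ℂ))) (k : ℕ) (x : complexBetti Y k) ↦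
    map_fiberι_map_fst_eq (X := Y) u k x
  refine ⟨Y ⊗ specOver ℂ (MvPolynomial (Fin 1) ℂ), specOver ℂ (MvPolynomial (Fin 1) ℂ), snd Y _, s₀, s₀, Y, θ,
    (sliceFiberIso Y s₀).symm, (sliceFiberIso Y s₀).symm, complexBetti.map (fst Y _) 2 θ, w, complexBetti.map (fst Y _) (2 * p) w,
    hf', h𝒳', irreducibleSpace_affineLine_left, isAffine_affineLine_left, smooth_affineLine_hom, topologicalKrullDim_affineLine_left,
    h𝔄Y, fun u ↦ ?_, fun u ↦ ?_, ?_, fun u₀ hu₀ hu₀Q ↦ ⟨complexBetti.map (fst Y _) (2 * p) u₀, ?_, fun u ↦ ?_⟩, hw, hwQ, ?_, ?_⟩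
  · rw [hres u]; exact hθQ.map _
  · rw [hres u, ← Iso.symm_hom]; exact (isOfHodgeType_map_iff_of_iso (sliceFiberIso Y u).symm).2 hθH
  · rw [hres s₀, Iso.symm_hom]
  · rw [hres s₀, Iso.symm_hom]
  · rw [hres u, ← Iso.symm_hom]; exact (isOfHodgeType_map_iff_of_iso (sliceFiberIso Y u).symm).2 (h𝔘 u₀ hu₀ hu₀Q)
  · rw [hres s₀, Iso.symm_hom]
  · rw [hres s₀, Iso.symm_hom]

/-! ## §2 The residual-pairs statement: antitone in the anchor family; the seam -/

/-- **THE RESIDUAL IS ANTITONE IN THE ANCHOR FAMILY** — shrinking `𝔄` to a sub-family `𝔄 ≤ 𝔄'` can only GROW the residual statement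
«every pair `(X, w)` (`X` isomorphic to an abelian `n`-fold, `w` rational of type `(p,p)`), neither algebraic-Lefschetz nor anchor-reachable,
is locally served»: the residual for the SMALLER family implies the residual for the LARGER one (a pair unreachable from `𝔄'` is unreachable
from `𝔄`). The v3.12 words «2r″ — IT GROWS» as a kernel statement. [cite: vanGeemen1994HodgeAV, §2.4] [cite: Markman2025SecantWeil, Thm. 1.5.1] -/
theorem localResidualPairs_antitone (h𝔄 : ∀ Y θ, 𝔄 Y θ → 𝔄' Y θ)
    (hres : ∀ (X : SchemeOver ℂ), (∃ A' : AbelianVariety ℂ, A'.dim = n ∧ Nonempty (A'.X ≅ X)) →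
      ∀ w : complexBetti X (2 * p), IsRationalClass w → IsOfHodgeType n X (2 * p) p p w →
        ¬ (w ∈ algebraicClasses X p ∧ w ∈ divisorClassesSpan X n p) → ¬ AnchorReachableAt n p 𝔄 𝔘 𝔏 X w →
        LocallyServedAt 𝒪 n p X w) :
    ∀ (X : SchemeOver ℂ), (∃ A' : AbelianVariety ℂ, A'.dim = n ∧ Nonempty (A'.X ≅ X)) →
      ∀ w : complexBetti X (2 * p), IsRationalClass w → IsOfHodgeType n X (2 * p) p p w →
        ¬ (w ∈ algebraicClasses X p ∧ w ∈ divisorClassesSpan X n p) → ¬ AnchorReachableAt n p 𝔄' 𝔘 𝔏 X w →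
        LocallyServedAt 𝒪 n p X w :=
  fun X hX w hwQ hwH hL hR ↦ hres X hX w hwQ hwH hL fun h ↦ hR (h.mono_anchors h𝔄)

/-- **THE SEAM — residual for the smaller family ⟸ residual for the larger family ∧ REACHABILITY TRANSFER**: if `𝔄 ≤ 𝔄'`, every
non-Lefschetz, non-`𝔄'`-reachable pair is served (the residual for the LARGER family), and every non-Lefschetz pair reachable from `𝔄'` is
reachable from `𝔄` OR served outright (the transfer — on paper, at `(6,3)` with `𝔄 = oHE ≤ oH = 𝔄'`, a Weil-cell pencil from a VERY GENERAL
point of the irreducible level family, LEAD 163 K0; displayed, not claimed), then the residual for the SMALLER family holds. So the growth of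
the residual stub under an anchor re-key is EXACTLY the transfer. (`𝔄 ≤ 𝔄'` is not even used: the transfer alone carries the implication.)
[cite: Markman2025SecantWeil, §1.5 and Thm. 1.5.1] [cite: Andre1996Motifs, §6.3] [cite: vanGeemen1994HodgeAV, §2.4] -/
theorem localResidualPairs_of_transfer
    (hres' : ∀ (X : SchemeOver ℂ), (∃ A' : AbelianVariety ℂ, A'.dim = n ∧ Nonempty (A'.X ≅ X)) →
      ∀ w : complexBetti X (2 * p), IsRationalClass w → IsOfHodgeType n X (2 * p) p p w →
        ¬ (w ∈ algebraicClasses X p ∧ w ∈ divisorClassesSpan X n p) → ¬ AnchorReachableAt n p 𝔄' 𝔘 𝔏 X w →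
        LocallyServedAt 𝒪 n p X w)
    (htransfer : ∀ (X : SchemeOver ℂ), (∃ A' : AbelianVariety ℂ, A'.dim = n ∧ Nonempty (A'.X ≅ X)) →
      ∀ w : complexBetti X (2 * p), IsRationalClass w → IsOfHodgeType n X (2 * p) p p w →
        ¬ (w ∈ algebraicClasses X p ∧ w ∈ divisorClassesSpan X n p) → AnchorReachableAt n p 𝔄' 𝔘 𝔏 X w →
        AnchorReachableAt n p 𝔄 𝔘 𝔏 X w ∨ LocallyServedAt 𝒪 n p X w) :
    ∀ (X : SchemeOver ℂ), (∃ A' : AbelianVariety ℂ, A'.dim = n ∧ Nonempty (A'.X ≅ X)) →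
      ∀ w : complexBetti X (2 * p), IsRationalClass w → IsOfHodgeType n X (2 * p) p p w →
        ¬ (w ∈ algebraicClasses X p ∧ w ∈ divisorClassesSpan X n p) → ¬ AnchorReachableAt n p 𝔄 𝔘 𝔏 X w →
        LocallyServedAt 𝒪 n p X w := by
  intro X hX w hwQ hwH hL hR
  by_cases h' : AnchorReachableAt n p 𝔄' 𝔘 𝔏 X w
  · rcases htransfer X hX w hwQ hwH hL h' with h | h
    · exact absurd h hR
    · exact h
  · exact hres' X hX w hwQ hwH hL h'

/-- **The local regime from span data at the SMALLER family, the residual for the LARGER family and the transfer** (the consumer's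
shape after a re-key: (G2) `lefAtExceptionalRegimeAtLocal_of_anchoredSpan_of_residual` fed by `localResidualPairs_of_transfer`).
[cite: Markman2025SecantWeil, Thm. 1.4.1 and Thm. 1.5.1] [cite: Bloch1972Semiregularity, Remark (7.5)] [cite: vanGeemen1994HodgeAV, §2.4 and Thm. 4.11] -/
theorem lefAtExceptionalRegimeAtLocal_of_anchoredSpan_of_residual_of_transfer
    (h𝒪 : ∀ (n : ℕ) ⦃Y Y' : SchemeOver ℂ⦄ (e : Y' ≅ Y) (I : Finset ℕ) (κ : (q : ℕ) → complexBetti Y (2 * q)),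
      𝒪 n Y I κ → 𝒪 n Y' I (fun q ↦ complexBetti.map e.hom (2 * q) (κ q)))
    (hspan : AnchoredSpanAt 𝒪 n p 𝔄 𝔘 𝔏)
    (hres' : ∀ (X : SchemeOver ℂ), (∃ A' : AbelianVariety ℂ, A'.dim = n ∧ Nonempty (A'.X ≅ X)) →
      ∀ w : complexBetti X (2 * p), IsRationalClass w → IsOfHodgeType n X (2 * p) p p w →
        ¬ (w ∈ algebraicClasses X p ∧ w ∈ divisorClassesSpan X n p) → ¬ AnchorReachableAt n p 𝔄' 𝔘 𝔏 X w →
        LocallyServedAt 𝒪 n p X w)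
    (htransfer : ∀ (X : SchemeOver ℂ), (∃ A' : AbelianVariety ℂ, A'.dim = n ∧ Nonempty (A'.X ≅ X)) →
      ∀ w : complexBetti X (2 * p), IsRationalClass w → IsOfHodgeType n X (2 * p) p p w →
        ¬ (w ∈ algebraicClasses X p ∧ w ∈ divisorClassesSpan X n p) → AnchorReachableAt n p 𝔄' 𝔘 𝔏 X w →
        AnchorReachableAt n p 𝔄 𝔘 𝔏 X w ∨ LocallyServedAt 𝒪 n p X w) :
    LefAtExceptionalRegimeAtLocal 𝒪 n p :=
  lefAtExceptionalRegimeAtLocal_of_anchoredSpan_of_residual h𝒪 hspan (localResidualPairs_of_transfer hres' htransfer)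

/-! ## §3 The `(6,3)` instances over the primed twisted door: oH (v3.11) versus oHE (v3.12) -/

/-- **2r″ ⟹ 2r′ᵒᴴ (the re-keyed stub is the STRONGER one)**: the residual-pairs statement for the `End`-TRIVIAL H-good off-hyperelliptic
presented pinned anchors (v3.12's 2r″, skeleton e7ce30df245290c2 :494, verbatim) implies the one for ALL H-good off-hyperelliptic presented
pinned anchors (v3.11's 2r′ᵒᴴ, skeleton 43a3e93a9cef966a, verbatim), for any door `𝒪` — `localResidualPairs_antitone` at the inclusion
oHE ≤ oH (forget `End`-triviality). [cite: Markman2025SecantWeil, §1.5 (p. 7) and Thm. 1.5.1] -/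
theorem localResidualPairs_63_offHypDisj_of_offHypDisjEnd
    (h : ∀ (X : SchemeOver ℂ), (∃ A' : AbelianVariety ℂ, A'.dim = 6 ∧ Nonempty (A'.X ≅ X)) →
      ∀ w : complexBetti X (2 * 3), IsRationalClass w → IsOfHodgeType 6 X (2 * 3) 3 3 w →
        ¬ (w ∈ algebraicClasses X 3 ∧ w ∈ divisorClassesSpan X 6 3) →
        ¬ AnchorReachableAt 6 3
            (fun Y θ ↦ secantQuotientAnchorsPinned Y θ ∧ ∃ (D : SecantQuotientDatum) (e : Y ≅ D.Y.X) (θ₀ : complexBetti D.𝒥.J.X 2),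
              ¬ D.𝒥.IsHyperelliptic ∧ OrbitTranslatesDisjoint D.𝒥 D.G₁ D.G₂ ∧ D.𝒥.J.IsPolarizationClassOf D.Θ θ₀ ∧
              (∀ f : D.𝒥.J ⟶ D.𝒥.J, ∃ n : ℤ, f = n • 𝟙 D.𝒥.J) ∧ complexBetti.map e.inv 2 θ = D.hY θ₀)
            (fun Y θ ↦ secantQuotientServedClassesPinned Y θ)
            (fun Y θ ↦ {w | ∃ γ, (γ = 0 ∨ γ ∈ secantQuotientServedClassesPinned Y θ) ∧ ∃ z : ℂ, w = γ + z • cupPowTwo θ 3}) X w →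
        LocallyServedAt 𝒪 6 3 X w) :
    ∀ (X : SchemeOver ℂ), (∃ A' : AbelianVariety ℂ, A'.dim = 6 ∧ Nonempty (A'.X ≅ X)) →
      ∀ w : complexBetti X (2 * 3), IsRationalClass w → IsOfHodgeType 6 X (2 * 3) 3 3 w →
        ¬ (w ∈ algebraicClasses X 3 ∧ w ∈ divisorClassesSpan X 6 3) →
        ¬ AnchorReachableAt 6 3
            (fun Y θ ↦ secantQuotientAnchorsPinned Y θ ∧ ∃ (D : SecantQuotientDatum) (e : Y ≅ D.Y.X) (θ₀ : complexBetti D.𝒥.J.X 2),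
              ¬ D.𝒥.IsHyperelliptic ∧ OrbitTranslatesDisjoint D.𝒥 D.G₁ D.G₂ ∧ D.𝒥.J.IsPolarizationClassOf D.Θ θ₀ ∧
              complexBetti.map e.inv 2 θ = D.hY θ₀)
            (fun Y θ ↦ secantQuotientServedClassesPinned Y θ)
            (fun Y θ ↦ {w | ∃ γ, (γ = 0 ∨ γ ∈ secantQuotientServedClassesPinned Y θ) ∧ ∃ z : ℂ, w = γ + z • cupPowTwo θ 3}) X w →
        LocallyServedAt 𝒪 6 3 X w :=
  localResidualPairs_antitone (𝔄' := fun Y θ ↦ secantQuotientAnchorsPinned Y θ ∧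
      ∃ (D : SecantQuotientDatum) (e : Y ≅ D.Y.X) (θ₀ : complexBetti D.𝒥.J.X 2),
        ¬ D.𝒥.IsHyperelliptic ∧ OrbitTranslatesDisjoint D.𝒥 D.G₁ D.G₂ ∧ D.𝒥.J.IsPolarizationClassOf D.Θ θ₀ ∧
        complexBetti.map e.inv 2 θ = D.hY θ₀)
    (fun Y θ (hY : secantQuotientAnchorsPinned Y θ ∧ ∃ (D : SecantQuotientDatum) (e : Y ≅ D.Y.X) (θ₀ : complexBetti D.𝒥.J.X 2),
        ¬ D.𝒥.IsHyperelliptic ∧ OrbitTranslatesDisjoint D.𝒥 D.G₁ D.G₂ ∧ D.𝒥.J.IsPolarizationClassOf D.Θ θ₀ ∧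
        (∀ f : D.𝒥.J ⟶ D.𝒥.J, ∃ n : ℤ, f = n • 𝟙 D.𝒥.J) ∧ complexBetti.map e.inv 2 θ = D.hY θ₀) ↦ by
      obtain ⟨hpin, D, e, θ₀, hnh, hH, hθ₀, -, he⟩ := hY
      exact ⟨hpin, D, e, θ₀, hnh, hH, hθ₀, he⟩) h

/-- **2r′ᵒᴴ ∧ TRANSFER ⟹ 2r″ (the growth of the re-keyed stub is EXACTLY the oH → oHE reachability transfer)**: v3.11's residual for ALL
H-good off-hyperelliptic presented pinned anchors, together with «every non-Lefschetz pair reachable from an H-good off-hyperelliptic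
presented anchor is reachable from an `End`-TRIVIAL one, or locally served outright» (DISPLAYED hypothesis `htransfer`; on paper the D1b density
lemma in its «very general» form — `End J = ℤ` off a countable union of proper closed subsets of the irreducible level family, and a
Weil-cell pencil from the chosen very general anchor to the target — LEAD 163 K0, ring2 INBOX l.5579; NOT claimed), gives v3.12's 2r″
verbatim, for any door `𝒪`. [cite: Markman2025SecantWeil, §1.5 (p. 7) and Thm. 1.5.1] [cite: Andre1996Motifs, §6.3]
[cite: DeligneHodgeII1971, Cor. 4.1.2] -/
theorem localResidualPairs_63_offHypDisjEnd_of_offHypDisj_of_transfer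
    (hres' : ∀ (X : SchemeOver ℂ), (∃ A' : AbelianVariety ℂ, A'.dim = 6 ∧ Nonempty (A'.X ≅ X)) →
      ∀ w : complexBetti X (2 * 3), IsRationalClass w → IsOfHodgeType 6 X (2 * 3) 3 3 w →
        ¬ (w ∈ algebraicClasses X 3 ∧ w ∈ divisorClassesSpan X 6 3) →
        ¬ AnchorReachableAt 6 3
            (fun Y θ ↦ secantQuotientAnchorsPinned Y θ ∧ ∃ (D : SecantQuotientDatum) (e : Y ≅ D.Y.X) (θ₀ : complexBetti D.𝒥.J.X 2),
              ¬ D.𝒥.IsHyperelliptic ∧ OrbitTranslatesDisjoint D.𝒥 D.G₁ D.G₂ ∧ D.𝒥.J.IsPolarizationClassOf D.Θ θ₀ ∧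
              complexBetti.map e.inv 2 θ = D.hY θ₀)
            (fun Y θ ↦ secantQuotientServedClassesPinned Y θ)
            (fun Y θ ↦ {w | ∃ γ, (γ = 0 ∨ γ ∈ secantQuotientServedClassesPinned Y θ) ∧ ∃ z : ℂ, w = γ + z • cupPowTwo θ 3}) X w →
        LocallyServedAt 𝒪 6 3 X w)
    (htransfer : ∀ (X : SchemeOver ℂ), (∃ A' : AbelianVariety ℂ, A'.dim = 6 ∧ Nonempty (A'.X ≅ X)) →
      ∀ w : complexBetti X (2 * 3), IsRationalClass w → IsOfHodgeType 6 X (2 * 3) 3 3 w →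
        ¬ (w ∈ algebraicClasses X 3 ∧ w ∈ divisorClassesSpan X 6 3) →
        AnchorReachableAt 6 3
            (fun Y θ ↦ secantQuotientAnchorsPinned Y θ ∧ ∃ (D : SecantQuotientDatum) (e : Y ≅ D.Y.X) (θ₀ : complexBetti D.𝒥.J.X 2),
              ¬ D.𝒥.IsHyperelliptic ∧ OrbitTranslatesDisjoint D.𝒥 D.G₁ D.G₂ ∧ D.𝒥.J.IsPolarizationClassOf D.Θ θ₀ ∧
              complexBetti.map e.inv 2 θ = D.hY θ₀)
            (fun Y θ ↦ secantQuotientServedClassesPinned Y θ)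
            (fun Y θ ↦ {w | ∃ γ, (γ = 0 ∨ γ ∈ secantQuotientServedClassesPinned Y θ) ∧ ∃ z : ℂ, w = γ + z • cupPowTwo θ 3}) X w →
        AnchorReachableAt 6 3
            (fun Y θ ↦ secantQuotientAnchorsPinned Y θ ∧ ∃ (D : SecantQuotientDatum) (e : Y ≅ D.Y.X) (θ₀ : complexBetti D.𝒥.J.X 2),
              ¬ D.𝒥.IsHyperelliptic ∧ OrbitTranslatesDisjoint D.𝒥 D.G₁ D.G₂ ∧ D.𝒥.J.IsPolarizationClassOf D.Θ θ₀ ∧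
              (∀ f : D.𝒥.J ⟶ D.𝒥.J, ∃ n : ℤ, f = n • 𝟙 D.𝒥.J) ∧ complexBetti.map e.inv 2 θ = D.hY θ₀)
            (fun Y θ ↦ secantQuotientServedClassesPinned Y θ)
            (fun Y θ ↦ {w | ∃ γ, (γ = 0 ∨ γ ∈ secantQuotientServedClassesPinned Y θ) ∧ ∃ z : ℂ, w = γ + z • cupPowTwo θ 3}) X w ∨
        LocallyServedAt 𝒪 6 3 X w) :
    ∀ (X : SchemeOver ℂ), (∃ A' : AbelianVariety ℂ, A'.dim = 6 ∧ Nonempty (A'.X ≅ X)) →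
      ∀ w : complexBetti X (2 * 3), IsRationalClass w → IsOfHodgeType 6 X (2 * 3) 3 3 w →
        ¬ (w ∈ algebraicClasses X 3 ∧ w ∈ divisorClassesSpan X 6 3) →
        ¬ AnchorReachableAt 6 3
            (fun Y θ ↦ secantQuotientAnchorsPinned Y θ ∧ ∃ (D : SecantQuotientDatum) (e : Y ≅ D.Y.X) (θ₀ : complexBetti D.𝒥.J.X 2),
              ¬ D.𝒥.IsHyperelliptic ∧ OrbitTranslatesDisjoint D.𝒥 D.G₁ D.G₂ ∧ D.𝒥.J.IsPolarizationClassOf D.Θ θ₀ ∧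
              (∀ f : D.𝒥.J ⟶ D.𝒥.J, ∃ n : ℤ, f = n • 𝟙 D.𝒥.J) ∧ complexBetti.map e.inv 2 θ = D.hY θ₀)
            (fun Y θ ↦ secantQuotientServedClassesPinned Y θ)
            (fun Y θ ↦ {w | ∃ γ, (γ = 0 ∨ γ ∈ secantQuotientServedClassesPinned Y θ) ∧ ∃ z : ℂ, w = γ + z • cupPowTwo θ 3}) X w →
        LocallyServedAt 𝒪 6 3 X w :=
  localResidualPairs_of_transfer hres' htransfer

/-! ## §4 (appended, ring2-b03x g16) Every PRESENTED pinned anchor reaches its own `𝔖^pin + ℂθ³` classes; oHE-reachable ⟹ oH-reachable -/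

/-- **A presented pinned secant–quotient anchor reaches each of its own rational `𝔖^pin + ℂθ³` classes** — for ANY presentation
predicate `P` (v3.11's oH: non-hyperelliptic ∧ `OrbitTranslatesDisjoint` ∧ pin; v3.12's oHE: moreover `End`-trivial; or none): the pinned
anchor predicate alone makes `Y` a copy of the abelian sixfold `Y_d` (`SecantQuotientDatum.isSmoothProjective_Y`) and `θ` a polarisation
class (`IsPolarizationClass 6 Y θ`: rational, and `(1,1)` because supported on a divisor — `isOfHodgeType_of_mem_algebraicClasses_of_isSmoothProjective`),
and every pinned-served direction is of type `(3,3)` (`IsSecantQuotientWeilClassAtPinned.isOfHodgeType`); so `AnchorReachableAt.of_self`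
applies (constant pencil). Together with `secantQuotientServedClassesPinned_subset_lefschetz` (every such class is algebraic-Lefschetz on
its anchor) this says: the anchors contribute NOTHING to the residual stub 2r″ as targets, under either key. Fact-free.
[cite: Markman2025SecantWeil, §1.5 (p. 7) and Thm. 1.4.1] [cite: Hartshorne1977, II.3 (p. 89)] [cite: VoisinHodgeI2002, §11.1.2 Prop. 11.20] -/
theorem anchorReachableAt_63_secantQuotientPinned_of_self {P : ∀ Y : SchemeOver ℂ, complexBetti Y 2 → Prop}
    {Y : SchemeOver ℂ} {θ : complexBetti Y 2} (hY : secantQuotientAnchorsPinned Y θ ∧ P Y θ)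
    {w : complexBetti Y (2 * 3)}
    (hw : w ∈ {w | ∃ γ, (γ = 0 ∨ γ ∈ secantQuotientServedClassesPinned Y θ) ∧ ∃ z : ℂ, w = γ + z • cupPowTwo θ 3})
    (hwQ : IsRationalClass w) :
    AnchorReachableAt 6 3 (fun Y θ ↦ secantQuotientAnchorsPinned Y θ ∧ P Y θ)
      (fun Y θ ↦ secantQuotientServedClassesPinned Y θ)
      (fun Y θ ↦ {w | ∃ γ, (γ = 0 ∨ γ ∈ secantQuotientServedClassesPinned Y θ) ∧ ∃ z : ℂ, w = γ + z • cupPowTwo θ 3}) Y w := by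
  obtain ⟨γ₀, D, e, θ₀, -, -, hpol, -⟩ := hY.1
  have hYsp : IsSmoothProjective 6 Y := D.isSmoothProjective_Y.of_iso e.symm
  exact AnchorReachableAt.of_self (𝔄 := fun Y θ ↦ secantQuotientAnchorsPinned Y θ ∧ P Y θ)
    (𝔘 := fun Y θ ↦ secantQuotientServedClassesPinned Y θ)
    (𝔏 := fun Y θ ↦ {w | ∃ γ, (γ = 0 ∨ γ ∈ secantQuotientServedClassesPinned Y θ) ∧ ∃ z : ℂ, w = γ + z • cupPowTwo θ 3})
    hYsp hY hpol.isRationalClass (isOfHodgeType_of_mem_algebraicClasses_of_isSmoothProjective hYsp 1 hpol.mem_algebraicClasses)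
    (fun u hu _ ↦ IsSecantQuotientWeilClassAtPinned.isOfHodgeType hu) hw hwQ

/-- **oHE-reachable ⟹ oH-reachable** (forget `End`-triviality of the presenting datum; `AnchorReachableAt.mono_anchors`): the pairs the
re-keyed line reaches were reached before. [cite: Markman2025SecantWeil, §1.5 (p. 7) and Thm. 1.5.1] -/
theorem anchorReachableAt_63_offHypDisj_of_offHypDisjEnd {X : SchemeOver ℂ} {w : complexBetti X (2 * 3)}
    (h : AnchorReachableAt 6 3
      (fun Y θ ↦ secantQuotientAnchorsPinned Y θ ∧ ∃ (D : SecantQuotientDatum) (e : Y ≅ D.Y.X) (θ₀ : complexBetti D.𝒥.J.X 2),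
        ¬ D.𝒥.IsHyperelliptic ∧ OrbitTranslatesDisjoint D.𝒥 D.G₁ D.G₂ ∧ D.𝒥.J.IsPolarizationClassOf D.Θ θ₀ ∧
        (∀ f : D.𝒥.J ⟶ D.𝒥.J, ∃ n : ℤ, f = n • 𝟙 D.𝒥.J) ∧ complexBetti.map e.inv 2 θ = D.hY θ₀)
      (fun Y θ ↦ secantQuotientServedClassesPinned Y θ)
      (fun Y θ ↦ {w | ∃ γ, (γ = 0 ∨ γ ∈ secantQuotientServedClassesPinned Y θ) ∧ ∃ z : ℂ, w = γ + z • cupPowTwo θ 3}) X w) :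
    AnchorReachableAt 6 3
      (fun Y θ ↦ secantQuotientAnchorsPinned Y θ ∧ ∃ (D : SecantQuotientDatum) (e : Y ≅ D.Y.X) (θ₀ : complexBetti D.𝒥.J.X 2),
        ¬ D.𝒥.IsHyperelliptic ∧ OrbitTranslatesDisjoint D.𝒥 D.G₁ D.G₂ ∧ D.𝒥.J.IsPolarizationClassOf D.Θ θ₀ ∧
        complexBetti.map e.inv 2 θ = D.hY θ₀)
      (fun Y θ ↦ secantQuotientServedClassesPinned Y θ)
      (fun Y θ ↦ {w | ∃ γ, (γ = 0 ∨ γ ∈ secantQuotientServedClassesPinned Y θ) ∧ ∃ z : ℂ, w = γ + z • cupPowTwo θ 3}) X w :=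
  h.mono_anchors (𝔄' := fun Y θ ↦ secantQuotientAnchorsPinned Y θ ∧
      ∃ (D : SecantQuotientDatum) (e : Y ≅ D.Y.X) (θ₀ : complexBetti D.𝒥.J.X 2),
        ¬ D.𝒥.IsHyperelliptic ∧ OrbitTranslatesDisjoint D.𝒥 D.G₁ D.G₂ ∧ D.𝒥.J.IsPolarizationClassOf D.Θ θ₀ ∧
        complexBetti.map e.inv 2 θ = D.hY θ₀)
    (fun Y θ (hY : secantQuotientAnchorsPinned Y θ ∧ ∃ (D : SecantQuotientDatum) (e : Y ≅ D.Y.X) (θ₀ : complexBetti D.𝒥.J.X 2),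
        ¬ D.𝒥.IsHyperelliptic ∧ OrbitTranslatesDisjoint D.𝒥 D.G₁ D.G₂ ∧ D.𝒥.J.IsPolarizationClassOf D.Θ θ₀ ∧
        (∀ f : D.𝒥.J ⟶ D.𝒥.J, ∃ n : ℤ, f = n • 𝟙 D.𝒥.J) ∧ complexBetti.map e.inv 2 θ = D.hY θ₀) ↦ by
      obtain ⟨hpin, D, e, θ₀, hnh, hH, hθ₀, -, he⟩ := hY
      exact ⟨hpin, D, e, θ₀, hnh, hH, hθ₀, he⟩)

/-! ## §5 (appended, ring2-b03x g16) EXACTNESS: residual(𝔄) ⟺ residual(𝔄′) ∧ transfer (𝔄 ≤ 𝔄′); the exclusion clause is `w ∉ Dᵖ` -/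

/-- **The transfer is implied by the residual for the smaller family ALONE** (a non-Lefschetz pair is `𝔄`-reachable or, being
non-`𝔄`-reachable, served) — registering the transfer separately loses nothing. [cite: vanGeemen1994HodgeAV, §2.4] [cite: Markman2025SecantWeil, Thm. 1.5.1] -/
theorem transfer_of_localResidualPairs
    (hres : ∀ (X : SchemeOver ℂ), (∃ A' : AbelianVariety ℂ, A'.dim = n ∧ Nonempty (A'.X ≅ X)) →
      ∀ w : complexBetti X (2 * p), IsRationalClass w → IsOfHodgeType n X (2 * p) p p w →
        ¬ (w ∈ algebraicClasses X p ∧ w ∈ divisorClassesSpan X n p) → ¬ AnchorReachableAt n p 𝔄 𝔘 𝔏 X w →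
        LocallyServedAt 𝒪 n p X w) :
    ∀ (X : SchemeOver ℂ), (∃ A' : AbelianVariety ℂ, A'.dim = n ∧ Nonempty (A'.X ≅ X)) →
      ∀ w : complexBetti X (2 * p), IsRationalClass w → IsOfHodgeType n X (2 * p) p p w →
        ¬ (w ∈ algebraicClasses X p ∧ w ∈ divisorClassesSpan X n p) → AnchorReachableAt n p 𝔄' 𝔘 𝔏 X w →
        AnchorReachableAt n p 𝔄 𝔘 𝔏 X w ∨ LocallyServedAt 𝒪 n p X w := by
  intro X hX w hwQ hwH hL _
  by_cases h : AnchorReachableAt n p 𝔄 𝔘 𝔏 X w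
  · exact Or.inl h
  · exact Or.inr (hres X hX w hwQ hwH hL h)

/-- **EXACT DECOMPOSITION OF A RE-KEYED RESIDUAL**: for `𝔄 ≤ 𝔄'`, residual(smaller `𝔄`) ⟺ residual(larger `𝔄'`) ∧ transfer
`𝔄' → 𝔄 ∨ served` — the re-key's growth is the transfer, no more and no less. [cite: vanGeemen1994HodgeAV, §2.4] [cite: Markman2025SecantWeil, Thm. 1.5.1] -/
theorem localResidualPairs_iff_of_le (h𝔄 : ∀ Y θ, 𝔄 Y θ → 𝔄' Y θ) :
    (∀ (X : SchemeOver ℂ), (∃ A' : AbelianVariety ℂ, A'.dim = n ∧ Nonempty (A'.X ≅ X)) →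
      ∀ w : complexBetti X (2 * p), IsRationalClass w → IsOfHodgeType n X (2 * p) p p w →
        ¬ (w ∈ algebraicClasses X p ∧ w ∈ divisorClassesSpan X n p) → ¬ AnchorReachableAt n p 𝔄 𝔘 𝔏 X w →
        LocallyServedAt 𝒪 n p X w) ↔
    (∀ (X : SchemeOver ℂ), (∃ A' : AbelianVariety ℂ, A'.dim = n ∧ Nonempty (A'.X ≅ X)) →
      ∀ w : complexBetti X (2 * p), IsRationalClass w → IsOfHodgeType n X (2 * p) p p w →
        ¬ (w ∈ algebraicClasses X p ∧ w ∈ divisorClassesSpan X n p) → ¬ AnchorReachableAt n p 𝔄' 𝔘 𝔏 X w →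
        LocallyServedAt 𝒪 n p X w) ∧
    (∀ (X : SchemeOver ℂ), (∃ A' : AbelianVariety ℂ, A'.dim = n ∧ Nonempty (A'.X ≅ X)) →
      ∀ w : complexBetti X (2 * p), IsRationalClass w → IsOfHodgeType n X (2 * p) p p w →
        ¬ (w ∈ algebraicClasses X p ∧ w ∈ divisorClassesSpan X n p) → AnchorReachableAt n p 𝔄' 𝔘 𝔏 X w →
        AnchorReachableAt n p 𝔄 𝔘 𝔏 X w ∨ LocallyServedAt 𝒪 n p X w) :=
  ⟨fun h ↦ ⟨localResidualPairs_antitone h𝔄 h, transfer_of_localResidualPairs h⟩, fun h ↦ localResidualPairs_of_transfer h.1 h.2⟩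

/-- **2r″ ⟺ 2r′ᵒᴴ ∧ (T)** — the `(6,3)` instance of `localResidualPairs_iff_of_le` at oHE ≤ oH over any door `𝒪` (both registered statements
verbatim; (T) displayed inline). [cite: Markman2025SecantWeil, §1.5 (p. 7) and Thm. 1.5.1] [cite: Andre1996Motifs, §6.3] -/
theorem localResidualPairs_63_offHypDisjEnd_iff :
    (∀ (X : SchemeOver ℂ), (∃ A' : AbelianVariety ℂ, A'.dim = 6 ∧ Nonempty (A'.X ≅ X)) →
      ∀ w : complexBetti X (2 * 3), IsRationalClass w → IsOfHodgeType 6 X (2 * 3) 3 3 w →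
        ¬ (w ∈ algebraicClasses X 3 ∧ w ∈ divisorClassesSpan X 6 3) →
        ¬ AnchorReachableAt 6 3
            (fun Y θ ↦ secantQuotientAnchorsPinned Y θ ∧ ∃ (D : SecantQuotientDatum) (e : Y ≅ D.Y.X) (θ₀ : complexBetti D.𝒥.J.X 2),
              ¬ D.𝒥.IsHyperelliptic ∧ OrbitTranslatesDisjoint D.𝒥 D.G₁ D.G₂ ∧ D.𝒥.J.IsPolarizationClassOf D.Θ θ₀ ∧
              (∀ f : D.𝒥.J ⟶ D.𝒥.J, ∃ n : ℤ, f = n • 𝟙 D.𝒥.J) ∧ complexBetti.map e.inv 2 θ = D.hY θ₀)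
            (fun Y θ ↦ secantQuotientServedClassesPinned Y θ)
            (fun Y θ ↦ {w | ∃ γ, (γ = 0 ∨ γ ∈ secantQuotientServedClassesPinned Y θ) ∧ ∃ z : ℂ, w = γ + z • cupPowTwo θ 3}) X w →
        LocallyServedAt 𝒪 6 3 X w) ↔
    (∀ (X : SchemeOver ℂ), (∃ A' : AbelianVariety ℂ, A'.dim = 6 ∧ Nonempty (A'.X ≅ X)) →
      ∀ w : complexBetti X (2 * 3), IsRationalClass w → IsOfHodgeType 6 X (2 * 3) 3 3 w →
        ¬ (w ∈ algebraicClasses X 3 ∧ w ∈ divisorClassesSpan X 6 3) →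
        ¬ AnchorReachableAt 6 3
            (fun Y θ ↦ secantQuotientAnchorsPinned Y θ ∧ ∃ (D : SecantQuotientDatum) (e : Y ≅ D.Y.X) (θ₀ : complexBetti D.𝒥.J.X 2),
              ¬ D.𝒥.IsHyperelliptic ∧ OrbitTranslatesDisjoint D.𝒥 D.G₁ D.G₂ ∧ D.𝒥.J.IsPolarizationClassOf D.Θ θ₀ ∧
              complexBetti.map e.inv 2 θ = D.hY θ₀)
            (fun Y θ ↦ secantQuotientServedClassesPinned Y θ)
            (fun Y θ ↦ {w | ∃ γ, (γ = 0 ∨ γ ∈ secantQuotientServedClassesPinned Y θ) ∧ ∃ z : ℂ, w = γ + z • cupPowTwo θ 3}) X w →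
        LocallyServedAt 𝒪 6 3 X w) ∧
    (∀ (X : SchemeOver ℂ), (∃ A' : AbelianVariety ℂ, A'.dim = 6 ∧ Nonempty (A'.X ≅ X)) →
      ∀ w : complexBetti X (2 * 3), IsRationalClass w → IsOfHodgeType 6 X (2 * 3) 3 3 w →
        ¬ (w ∈ algebraicClasses X 3 ∧ w ∈ divisorClassesSpan X 6 3) →
        AnchorReachableAt 6 3
            (fun Y θ ↦ secantQuotientAnchorsPinned Y θ ∧ ∃ (D : SecantQuotientDatum) (e : Y ≅ D.Y.X) (θ₀ : complexBetti D.𝒥.J.X 2),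
              ¬ D.𝒥.IsHyperelliptic ∧ OrbitTranslatesDisjoint D.𝒥 D.G₁ D.G₂ ∧ D.𝒥.J.IsPolarizationClassOf D.Θ θ₀ ∧
              complexBetti.map e.inv 2 θ = D.hY θ₀)
            (fun Y θ ↦ secantQuotientServedClassesPinned Y θ)
            (fun Y θ ↦ {w | ∃ γ, (γ = 0 ∨ γ ∈ secantQuotientServedClassesPinned Y θ) ∧ ∃ z : ℂ, w = γ + z • cupPowTwo θ 3}) X w →
        AnchorReachableAt 6 3
            (fun Y θ ↦ secantQuotientAnchorsPinned Y θ ∧ ∃ (D : SecantQuotientDatum) (e : Y ≅ D.Y.X) (θ₀ : complexBetti D.𝒥.J.X 2),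
              ¬ D.𝒥.IsHyperelliptic ∧ OrbitTranslatesDisjoint D.𝒥 D.G₁ D.G₂ ∧ D.𝒥.J.IsPolarizationClassOf D.Θ θ₀ ∧
              (∀ f : D.𝒥.J ⟶ D.𝒥.J, ∃ n : ℤ, f = n • 𝟙 D.𝒥.J) ∧ complexBetti.map e.inv 2 θ = D.hY θ₀)
            (fun Y θ ↦ secantQuotientServedClassesPinned Y θ)
            (fun Y θ ↦ {w | ∃ γ, (γ = 0 ∨ γ ∈ secantQuotientServedClassesPinned Y θ) ∧ ∃ z : ℂ, w = γ + z • cupPowTwo θ 3}) X w ∨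
        LocallyServedAt 𝒪 6 3 X w) :=
  localResidualPairs_iff_of_le (𝔄' := fun Y θ ↦ secantQuotientAnchorsPinned Y θ ∧
      ∃ (D : SecantQuotientDatum) (e : Y ≅ D.Y.X) (θ₀ : complexBetti D.𝒥.J.X 2),
        ¬ D.𝒥.IsHyperelliptic ∧ OrbitTranslatesDisjoint D.𝒥 D.G₁ D.G₂ ∧ D.𝒥.J.IsPolarizationClassOf D.Θ θ₀ ∧
        complexBetti.map e.inv 2 θ = D.hY θ₀)
    (fun Y θ (hY : secantQuotientAnchorsPinned Y θ ∧ ∃ (D : SecantQuotientDatum) (e : Y ≅ D.Y.X) (θ₀ : complexBetti D.𝒥.J.X 2),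
        ¬ D.𝒥.IsHyperelliptic ∧ OrbitTranslatesDisjoint D.𝒥 D.G₁ D.G₂ ∧ D.𝒥.J.IsPolarizationClassOf D.Θ θ₀ ∧
        (∀ f : D.𝒥.J ⟶ D.𝒥.J, ∃ n : ℤ, f = n • 𝟙 D.𝒥.J) ∧ complexBetti.map e.inv 2 θ = D.hY θ₀) ↦ by
      obtain ⟨hpin, D, e, θ₀, hnh, hH, hθ₀, -, he⟩ := hY
      exact ⟨hpin, D, e, θ₀, hnh, hH, hθ₀, he⟩)

/-- **On a copy of an abelian `n`-fold (the residual stubs' binder), «¬(algebraic ∧ Lefschetz)» ⟺ «not Lefschetz»**: `Dᵖ(X) ⊗ ℂ ⊆ NᵖH^{2p}(X)`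
(`divisorClassesSpan_le_algebraicClasses_of_isSmoothProjective`), so the exclusion clause is just `w ∉ Dᵖ(X) ⊗ ℂ`. [cite: VoisinHodgeI2002, Thm. 11.30] -/
theorem not_algebraic_and_lefschetz_iff_not_mem_divisorClassesSpan_of_abelian
    (hX : ∃ A' : AbelianVariety ℂ, A'.dim = n ∧ Nonempty (A'.X ≅ X)) {w : complexBetti X (2 * p)} :
    ¬ (w ∈ algebraicClasses X p ∧ w ∈ divisorClassesSpan X n p) ↔ w ∉ divisorClassesSpan X n p := by
  obtain ⟨A', hd, ⟨e⟩⟩ := hX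
  subst hd
  have hXsp : IsSmoothProjective A'.dim X := (AbelianVariety.isSmoothProjective_holds (A := A')).of_iso e
  exact ⟨fun h hw ↦ h ⟨divisorClassesSpan_le_algebraicClasses_of_isSmoothProjective hXsp p hw, hw⟩, fun h hw ↦ h hw.2⟩

end Summit.HodgeConjecture.HodgeConjecture.Ring2.SemiregularRepresentatives

end
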